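import Literature.NumberTheory.EllipticCurves.BSDSelmer
import Literature.NumberTheory.EllipticCurves.OpenImage
import Literature.NumberTheory.EllipticCurves.ComplexMultiplicationIsogenyProofs
import Literature.NumberTheory.EllipticCurves.SupersingularDensityProofs
import Literature.NumberTheory.EllipticCurves.PAdicHeightsProofs
import Literature.NumberTheory.EllipticCurves.BSDInvariantsProofs
import Literature.NumberTheory.EllipticCurves.GlobalMinimalModelProofs
import Literature.NumberTheory.EllipticCurves.ModPIrreducibleCofinite
import Literature.NumberTheory.EllipticCurves.ComplexMultiplicationRationalJIntegralProofs
import HarnessLib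

/-!
# Skinner's converse theorem (Thm. A′) as a special case of Kim's `p`-converse (Cor. 1.4)

Family `bsd`, companion to `Literature.NumberTheory.EllipticCurves.BSDSelmer` (bsd.S25). The
named fact `skinner_analyticRank_eq_one_of_mordellWeilRank_eq_one` transcribes C. Skinner,
*A converse to a theorem of Gross, Zagier, and Kolyvagin*, Ann. of Math. 191 (2020) =
arXiv:1405.7294, **Theorem A′** (p. 3 of the held text): "Suppose `E` is a semistable elliptic
curve over `ℚ`. If there is at least one odd prime at which `E` has nonsplit multiplicative
reduction or at least two odd primes at which `E` has split multiplicative reduction, then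
`rank_ℤ E(ℚ) = 1` and `#Ш(E) < ∞ ⟹ ord_{s=1} L(E,s) = 1`."

The printed proof (§1, pp. 3–4 and §3, p. 15 of the held text) is deep: A′ ⇐ A by modularity;
A ⇐ B (a `p`-adic criterion over an imaginary quadratic field, proved by the Iwasawa theory of
`V` over `K`: Wan's divisibility in the anticyclotomic main conjecture, the `p`-adic formulae of
Bertolini–Darmon–Prasanna and Brooks, the general Gross–Zagier formula of Yuan–Zhang–Zhang and
Kolyvagin), through Serre's density theorem, Ribet's irreducibility and level-lowering, Nekovář's
parity theorem, a Friedberg–Hoffstein twist and Gross–Zagier–Kolyvagin/Kato for the twist. None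
of this is available, so `skinner_analyticRank_eq_one_of_mordellWeilRank_eq_one_holds` is NOT
landed here.

What this file proves is the reduction, stated in print by C.-H. Kim, *On the soft `p`-converse
to a theorem of Gross–Zagier and Kolyvagin*, Math. Ann. 387 (2022) = arXiv:2109.12344, §1, p. 3
of the held text, after **Corollary 1.4** ("Let `E` be a non-CM elliptic curve over `ℚ`. If
`rk_ℤ E(ℚ) = 1` and `#Ш(E/ℚ)[p^∞] < ∞` for at least one good ordinary prime `p > 3` such that
`E[p]` is irreducible, then `ord_{s=1} L(E, s) = 1`"): *"This type of the `p`-converse theorem is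
first proved by Skinner [skinner-converse] and W. Zhang […]. In [skinner-converse], the
conductor is square-free and satisfies a certain existence condition on split/non-split
reduction primes. […] We completely remove these assumptions on the conductor"*, together with
Remark 1.3, same page: *"For a non-CM elliptic curve `E`, the density of good ordinary primes
for `E` is one [serre-density] and `E[p]` is an irreducible Galois representation for a
sufficiently large prime `p ≫ 0`"*, and diagram (1.1) (same page: for every `E/ℚ`,
`rk = 1 ∧ #Ш < ∞ ⟹ ord = 1` through Cor. 1.4 for non-CM `E`). That is: Theorem A′ is the
special case of Cor. 1.4 obtained by choosing the auxiliary prime `p`, once one knows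

* (i) a curve with a prime of multiplicative reduction has no CM — Skinner, p. 3 of the held
  text: *"If `N` is squarefree, then `A_f` does not have complex multiplication"* (the
  `j`-invariant of a CM curve is an algebraic integer, Silverman, *Advanced Topics*, Thm. II.6.1,
  while `j` is not integral at a multiplicative prime, *AEC*, Prop. VII.5.1(b) and VII.5.5);
  here from `‖j(E)‖_ℓ > 1` at a multiplicative prime `ℓ` (tree theorem
  `one_lt_norm_j_of_hasMultiplicativeReductionAtPrime`) against the integrality of the thirteen
  rational CM `j`-invariants (Silverman, *AEC*, App. C §11; tree named fact
  `j_mem_cmJInvariants_of_hasCM`, hypothesis `hCM`);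
* (ii) every `E/ℚ` has infinitely many good ordinary primes (Serre 1981, §8; tree theorem
  `WeierstrassCurve.infinite_goodOrdinaryPrimes_holds`, PROVED), so one with `p > 163`;
* (iii) `E[p]` is irreducible for every prime `p ∉ {2, 3, 5, 7, 11, 13, 17, 19, 37, 43, 67, 163}`
  (Mazur 1978, Thm. 1; tree named fact `mazur_isogeny_irreducible`, hypothesis `hMazur`; Kim
  cites Serre for "`p` sufficiently large", Mazur's uniform form is what the tree holds);
* (iv) the statement is about the curve, not the equation: Kim's corollary is vendored for a
  globally minimal model, Skinner's for any model, and rank, finiteness of `Ш`, the analytic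
  rank and the `j`-invariant are invariant under admissible changes of variables (tree theorems
  `hasGlobalMinimalModel_rat_holds`, `mordellWeilRank_variableChange_holds`, `shaEquiv`,
  `analyticRank_smul`, Mathlib `variableChange_j`; Silverman, *AEC*, VIII.8 Cor. 8.3, III.3.1(b),
  X.§4, C.16).

## Contents

* `exists_int_cast_eq_of_mem_cmJInvariants`, `norm_padic_le_one_of_mem_cmJInvariants` — the
  thirteen CM `j`-invariants are integers, hence `ℓ`-adically integral (proved by enumeration).
* `not_hasCM_of_hasMultiplicativeReductionAtPrime` — (i), relative to `j_mem_cmJInvariants_of_hasCM`.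
* `skinner_analyticRank_eq_one_of_mordellWeilRank_eq_one_of_facts` — Theorem A′ from Kim's
  Cor. 1.4 (`kim_analyticRank_eq_one_of_mordellWeilRank_eq_one`), Mazur's Thm. 1
  (`mazur_isogeny_irreducible`) and the `only if` half of the CM classification
  (`j_mem_cmJInvariants_of_hasCM`), everything else proved.
* `skinner_analyticRank_eq_one_of_mordellWeilRank_eq_one_of_kim_of_cm` (addendum 2026-08-15) —
  Theorem A′ from Kim's Cor. 1.4 and the CM classification **alone**: step (iii) no longer uses
  Mazur's theorem but the tree's theorem
  `WeierstrassCurve.exists_gt_mem_goodOrdinaryPrimes_hasIrreducibleModPGaloisRep`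
  (`ModPIrreducibleCofinite`: Silverman, *AEC*, Cor. IX.6.3 (Serre), `E[p]` is irreducible for
  all but finitely many `p`, proved unconditionally over `ℚ` from Shafarevich's theorem, with
  Serre 1981 §8 for the good ordinary primes) — exactly Kim's Remark 1.3 ("`E[p]` is an
  irreducible Galois representation for a sufficiently large prime `p ≫ 0`").
* `not_hasCM_of_hasMultiplicativeReductionAtPrime'` and
  `skinner_analyticRank_eq_one_of_mordellWeilRank_eq_one_of_kim` (second addendum 2026-08-15) —
  step (i) no longer uses the classification of rational CM `j`-invariants but the tree's theorem
  `WeierstrassCurve.not_hasCM_of_one_lt_norm_j` (`ComplexMultiplicationRationalJIntegralProofs`: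
  the `j`-invariant of a CM curve over `ℚ` is an integer, Silverman *Advanced Topics* Thm. II.6.1,
  proved along Cox's proof of Thm. 11.1 with the diagonal `Φ_q(X, X)` of the modular equation).
  **Theorem A′ now rests on Kim 2022, Cor. 1.4 alone**:
  `skinner_analyticRank_eq_one_of_mordellWeilRank_eq_one_holds` will be
  `skinner_analyticRank_eq_one_of_mordellWeilRank_eq_one_of_kim
    kim_analyticRank_eq_one_of_mordellWeilRank_eq_one_holds`.

## Design notes

* No definition and no new named fact is introduced (D-0026): the three inputs are named facts
  that already exist in the tree, taken as hypotheses; the semistability hypothesis and the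
  parity/oddness conditions of Theorem A′ are used only through "some prime of multiplicative
  reduction exists" (both alternatives of `hred` provide one), exactly the content of Kim's
  remark that Cor. 1.4 removes Skinner's conditions on the conductor.
* Trust base of Theorem A′ after this file: Kim 2022 Cor. 1.4 (itself: Kato, Skinner–Urban and
  Wan's main conjectures inverting `p`, and Perrin-Riou's conjecture by
  Bertolini–Darmon–Venerucci), Mazur 1978 Thm. 1, Silverman *AEC* C.11 (Baker–Heegner–Stark).
  `skinner_analyticRank_eq_one_of_mordellWeilRank_eq_one_holds` is one line from the three
  corresponding `_holds`.
* After the addendum the trust base is Kim 2022 Cor. 1.4 and Silverman *AEC* C.11 only: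
  `skinner_analyticRank_eq_one_of_mordellWeilRank_eq_one_holds` is
  `skinner_analyticRank_eq_one_of_mordellWeilRank_eq_one_of_kim_of_cm
    kim_analyticRank_eq_one_of_mordellWeilRank_eq_one_holds j_mem_cmJInvariants_of_hasCM_holds`
  once those two discharges exist (for the CM input any of the tree's reductions of
  `j_mem_cmJInvariants_of_hasCM` to the Heegner–Baker–Stark leaf may be substituted).

## References

* [Skinner2020] C. Skinner, *A converse to a theorem of Gross, Zagier, and Kolyvagin*, Ann. of
  Math. 191 (2020), 329–354 = arXiv:1405.7294: Thm. A′ and the remark "If `N` is squarefree,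
  then `A_f` does not have complex multiplication" (p. 3), §1 (pp. 3–4), §3 (p. 15). Pages of the
  held text (`lit read arxiv:1405.7294`). Edition concordance (ARM P D-AUDIT-r06, sheet 419e973b70199756, Table E,
  2026-08-26): the statements of arXiv v1 and of the Annals print agree word for word; the «p. N»
  locators of the held text are arXiv-v1 chunk numbers, the PRINT pages being Thm. A / A′
  pp. 330–331, Thm. B p. 331, Thm. C p. 332, §2.1 pp. 335–336, Lemma 2.2.2 (= v1 «Lemma 2»,
  rank1lemma) p. 338, §3 pp. 350–351 (print text `paper:url-0fde7123394a`, page = chunk + 328).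
* [Kim2022] C.-H. Kim, *On the soft `p`-converse to a theorem of Gross–Zagier and Kolyvagin*,
  Math. Ann. 387 (2022), 1961–1968 = arXiv:2109.12344: Cor. 1.4, Remark 1.3, diagram (1.1) and
  the comparison with [skinner-converse] (p. 3 of the held text).
* [Mazur1978] B. Mazur, *Rational isogenies of prime degree*, Invent. Math. 44 (1978), Thm. 1.
* [SilvermanAEC2009] J. H. Silverman, *The Arithmetic of Elliptic Curves*, 2nd ed.:
  Prop. VII.5.1(b), Prop. VII.5.5, VIII.8 Cor. 8.3, Cor. IX.6.3, App. C §11 and §16.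
* [SilvermanATAEC1994] J. H. Silverman, *Advanced Topics in the Arithmetic of Elliptic Curves*
  (1994): Thm. II.6.1 (integrality of CM `j`-invariants, PDF p. 139), App. A §3 (the thirteen values).
* [Cox2013] D. A. Cox, *Primes of the form x² + ny²*, 2nd ed. (2013), §11.D Thm. 11.1.
* [Serre1981] J.-P. Serre, *Quelques applications du théorème de densité de Chebotarev*, Publ.
  Math. IHÉS 54 (1981), §8.
-/

noncomputable section

open scoped Classical

open WeierstrassCurve

namespace Literature.NumberTheory.EllipticCurves

/-! ### The thirteen CM `j`-invariants are integers -/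

/-- Each of the thirteen rational CM `j`-invariants (`WeierstrassCurve.cmJInvariants`, Silverman,
*AEC*, App. C §11; *Advanced Topics*, App. A §3) is an integer. [cite: SilvermanAEC2009, App. C §11] -/
theorem exists_int_cast_eq_of_mem_cmJInvariants {j : ℚ} (hj : j ∈ cmJInvariants) :
    ∃ n : ℤ, (n : ℚ) = j := by
  simp only [cmJInvariants, Finset.mem_insert, Finset.mem_singleton] at hj
  rcases hj with rfl | rfl | rfl | rfl | rfl | rfl | rfl | rfl | rfl | rfl | rfl | rfl | rfl
  exacts [⟨0, by norm_num⟩, ⟨1728, by norm_num⟩, ⟨-3375, by norm_num⟩, ⟨8000, by norm_num⟩,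
    ⟨-32768, by norm_num⟩, ⟨54000, by norm_num⟩, ⟨287496, by norm_num⟩, ⟨-884736, by norm_num⟩,
    ⟨-12288000, by norm_num⟩, ⟨16581375, by norm_num⟩, ⟨-884736000, by norm_num⟩,
    ⟨-147197952000, by norm_num⟩, ⟨-262537412640768000, by norm_num⟩]

/-- Hence a rational CM `j`-invariant is an `ℓ`-adic integer for every prime `ℓ`:
`‖j‖_ℓ ≤ 1`. [cite: SilvermanAEC2009, App. C §11] -/
theorem norm_padic_le_one_of_mem_cmJInvariants {j : ℚ} (hj : j ∈ cmJInvariants) (ℓ : ℕ)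
    [Fact ℓ.Prime] : ‖(j : ℚ_[ℓ])‖ ≤ 1 := by
  obtain ⟨n, rfl⟩ := exists_int_cast_eq_of_mem_cmJInvariants hj
  rw [Rat.cast_intCast]
  exact Padic.norm_int_le_one n

/-! ### (i) A prime of multiplicative reduction excludes complex multiplication -/

/-- **A curve over `ℚ` with a prime of multiplicative reduction has no complex multiplication**
(Skinner 2020, p. 3 of the held text: "If `N` is squarefree, then `A_f` does not have complex
multiplication"; conceptually: the `j`-invariant of a CM curve is an algebraic integer,
Silverman, *Advanced Topics*, Thm. II.6.1, while `j` is non-integral at a multiplicative prime,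
*AEC*, Prop. VII.5.1(b), VII.5.5), here relative to the `only if` half of the classification of
rational CM `j`-invariants, `j_mem_cmJInvariants_of_hasCM` (Silverman, *AEC*, App. C §11):
multiplicative reduction at `ℓ` gives `‖j(E)‖_ℓ > 1`
(`one_lt_norm_j_of_hasMultiplicativeReductionAtPrime`, *AEC* Prop. VII.5.1(b)), whereas the
thirteen CM `j`-invariants are integers (`norm_padic_le_one_of_mem_cmJInvariants`). [cite: Skinner2020, §1 (p. 3 of the held text)] [cite: SilvermanAEC2009, Prop. VII.5.1(b) and App. C §11] [cite: SilvermanATAEC1994, Thm. II.6.1] -/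
theorem not_hasCM_of_hasMultiplicativeReductionAtPrime (hCM : j_mem_cmJInvariants_of_hasCM)
    (W : WeierstrassCurve ℚ) [W.IsElliptic] {ℓ : ℕ} [Fact ℓ.Prime]
    (hmult : W.HasMultiplicativeReductionAtPrime ℓ) : ¬ W.HasCM := fun h ↦
  absurd (one_lt_norm_j_of_hasMultiplicativeReductionAtPrime hmult)
    (not_lt.2 (norm_padic_le_one_of_mem_cmJInvariants (hCM W h) ℓ))

/-! ### Theorem A′ from Kim's Cor. 1.4, Mazur's theorem and the CM classification -/

/-- **Skinner 2020, Theorem A′, as a special case of Kim 2022, Corollary 1.4** (Kim, Math. Ann.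
387 (2022) = arXiv:2109.12344, §1, p. 3 of the held text: "This type of the `p`-converse theorem
is first proved by Skinner [skinner-converse] […]. In [skinner-converse], the conductor is
square-free and satisfies a certain existence condition on split/non-split reduction primes. […]
We completely remove these assumptions on the conductor", with Remark 1.3 "For a non-CM elliptic
curve `E`, the density of good ordinary primes for `E` is one and `E[p]` is an irreducible Galois
representation for a sufficiently large prime `p ≫ 0`" and diagram (1.1)). Hypotheses: Kim's
Cor. 1.4 (`hKim`, tree `kim_analyticRank_eq_one_of_mordellWeilRank_eq_one`), Mazur 1978 Thm. 1
(`hMazur`, tree `mazur_isogeny_irreducible`), and the `only if` half of the classification of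
rational CM `j`-invariants (`hCM`, tree `j_mem_cmJInvariants_of_hasCM`). Proof: both
alternatives of the reduction hypothesis give a prime `ℓ` of multiplicative reduction, so `E` has
no CM (`not_hasCM_of_hasMultiplicativeReductionAtPrime`, applied to a global minimal model
`C • W`, `hasGlobalMinimalModel_rat_holds`, whose `j`-invariant is `j(W)`, Mathlib
`variableChange_j`); `C • W` has infinitely many good ordinary primes
(`infinite_goodOrdinaryPrimes_holds`), so one with `p > 163`, at which `E[p]` is irreducible by
Mazur (`not_mem_mazurPrimes_of_lt`); `rank_ℤ (C • W)(ℚ) = rank_ℤ W(ℚ) = 1`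
(`mordellWeilRank_variableChange_holds`), `Ш(C • W) ≃ Ш(W)` is finite (`shaEquiv`), so is its
`p`-primary part; Cor. 1.4 gives `ord_{s=1} L(C • W, s) = 1`, and
`ord_{s=1} L(C • W, s) = ord_{s=1} L(W, s)` (`analyticRank_smul`). The semistability hypothesis
is not needed beyond the existence of `ℓ`. [cite: Kim2022, Cor. 1.4, Remark 1.3 and the discussion following Cor. 1.4 (p. 3)] [cite: Skinner2020, Thm. A′ (p. 3)] [cite: Mazur1978, Thm 1] [cite: SilvermanAEC2009, App. C §11; VIII.8 Cor. 8.3] -/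
theorem skinner_analyticRank_eq_one_of_mordellWeilRank_eq_one_of_facts
    (hKim : kim_analyticRank_eq_one_of_mordellWeilRank_eq_one)
    (hMazur : mazur_isogeny_irreducible) (hCM : j_mem_cmJInvariants_of_hasCM) :
    skinner_analyticRank_eq_one_of_mordellWeilRank_eq_one := by
  intro W _ _hss hred hrank hsha
  -- a prime `ℓ` of multiplicative reduction, from either alternative of `hred`
  obtain ⟨ℓ, hℓ, hmult⟩ : ∃ ℓ : ℕ, ∃ _ : Fact ℓ.Prime, W.HasMultiplicativeReductionAtPrime ℓ := by
    rcases hred with ⟨ℓ, hℓ, -, hm, -⟩ | ⟨ℓ, -, hℓ, -, -, -, -, hs, -⟩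
    · exact ⟨ℓ, hℓ, hm⟩
    · exact ⟨ℓ, hℓ, hs.hasMultiplicativeReductionAtPrime⟩
  -- (iv) a global minimal model `C • W` (Silverman VIII.8.3)
  obtain ⟨C, hC⟩ := hasGlobalMinimalModel_rat_holds W
  -- (i) no CM: `j(C • W) = j(W)` is not `ℓ`-integral
  have hcm : ¬ (C • W).HasCM := fun h ↦ by
    have hj : W.j ∈ cmJInvariants := by simpa only [variableChange_j] using hCM (C • W) h
    exact absurd (one_lt_norm_j_of_hasMultiplicativeReductionAtPrime hmult)
      (not_lt.2 (norm_padic_le_one_of_mem_cmJInvariants hj ℓ))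
  -- (ii) a good ordinary prime `p > 163` of the minimal model
  obtain ⟨p, ⟨hp, hgood, hord⟩, hgt⟩ := (infinite_goodOrdinaryPrimes_holds (C • W)).exists_gt 163
  -- (iii) Mazur: `E[p]` is irreducible
  have hirr : (C • W).HasIrreducibleModPGaloisRep p :=
    hMazur (C • W) p hp.out (not_mem_mazurPrimes_of_lt hgt)
  -- (iv) rank and finiteness of `Ш` are carried by the isomorphism `C`
  have hrank' : (C • W).mordellWeilRank = 1 := by
    have h : (C • W).mordellWeilRank = W.mordellWeilRank := mordellWeilRank_variableChange_holds W C
    rw [h, hrank]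
  haveI : Finite (C • W).sha := (Equiv.finite_iff (shaEquiv W C)).mp hsha
  have hshap : Finite (AddCommGroup.primaryComponent (C • W).sha p) := inferInstance
  -- Kim's Cor. 1.4 for `C • W` at `p`, and invariance of the analytic rank
  have h1 := (hKim (C • W) hcm p (by omega) hgood hord hirr hrank' hshap).1
  rwa [analyticRank_smul] at h1

/-! ### Addendum: Theorem A′ from Kim's Cor. 1.4 and the CM classification alone -/

/-- **Skinner 2020, Theorem A′, from Kim 2022, Corollary 1.4 and the CM classification — Mazur's
theorem removed.** Hypotheses: Kim's Cor. 1.4 (`hKim`, tree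
`kim_analyticRank_eq_one_of_mordellWeilRank_eq_one`) and the `only if` half of the
classification of rational CM `j`-invariants (`hCM`, tree `j_mem_cmJInvariants_of_hasCM`).
Compared with `skinner_analyticRank_eq_one_of_mordellWeilRank_eq_one_of_facts`, the auxiliary
prime is now supplied by a theorem of the tree: for the global minimal model `C • W`
(`hasGlobalMinimalModel_rat_holds`) there is a good ordinary prime `p > 3` at which `E[p]` is
irreducible (`WeierstrassCurve.exists_gt_mem_goodOrdinaryPrimes_hasIrreducibleModPGaloisRep`:
Silverman, *AEC*, Cor. IX.6.3 (Serre) — `E[p]` irreducible for all but finitely many `p`, proved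
from Shafarevich's theorem — and Serre 1981 §8, infinitely many good ordinary primes), which is
Kim's Remark 1.3 verbatim ("the density of good ordinary primes for `E` is one and `E[p]` is an
irreducible Galois representation for a sufficiently large prime `p ≫ 0`"). The rest is as
before: a multiplicative prime `ℓ` (either alternative of `hred`) excludes CM through
`‖j‖_ℓ > 1` against the integrality of the thirteen CM `j`-invariants; rank, finiteness of `Ш`
and the analytic rank pass to `C • W` (`mordellWeilRank_variableChange_holds`, `shaEquiv`,
`analyticRank_smul`); Cor. 1.4 concludes. Trust base: Kim 2022 Cor. 1.4 and *AEC* App. C §11.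
[cite: Kim2022, Cor. 1.4 and Remark 1.3 (p. 3 of the held text)] [cite: Skinner2020, Thm. A′ (p. 3)] [cite: SilvermanAEC2009, Cor. IX.6.3 and App. C §11] -/
theorem skinner_analyticRank_eq_one_of_mordellWeilRank_eq_one_of_kim_of_cm
    (hKim : kim_analyticRank_eq_one_of_mordellWeilRank_eq_one)
    (hCM : j_mem_cmJInvariants_of_hasCM) :
    skinner_analyticRank_eq_one_of_mordellWeilRank_eq_one := by
  intro W _ _hss hred hrank hsha
  -- a prime `ℓ` of multiplicative reduction, from either alternative of `hred`
  obtain ⟨ℓ, hℓ, hmult⟩ : ∃ ℓ : ℕ, ∃ _ : Fact ℓ.Prime, W.HasMultiplicativeReductionAtPrime ℓ := by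
    rcases hred with ⟨ℓ, hℓ, -, hm, -⟩ | ⟨ℓ, -, hℓ, -, -, -, -, hs, -⟩
    · exact ⟨ℓ, hℓ, hm⟩
    · exact ⟨ℓ, hℓ, hs.hasMultiplicativeReductionAtPrime⟩
  -- a global minimal model `C • W` (Silverman VIII.8.3)
  obtain ⟨C, hC⟩ := hasGlobalMinimalModel_rat_holds W
  -- no CM: `j(C • W) = j(W)` is not `ℓ`-integral
  have hcm : ¬ (C • W).HasCM := fun h ↦ by
    have hj : W.j ∈ cmJInvariants := by simpa only [variableChange_j] using hCM (C • W) h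
    exact absurd (one_lt_norm_j_of_hasMultiplicativeReductionAtPrime hmult)
      (not_lt.2 (norm_padic_le_one_of_mem_cmJInvariants hj ℓ))
  -- a good ordinary prime `p > 3` of the minimal model with `E[p]` irreducible (AEC IX.6.3)
  obtain ⟨p, hgt, ⟨hp, hgood, hord⟩, hirr⟩ :=
    (C • W).exists_gt_mem_goodOrdinaryPrimes_hasIrreducibleModPGaloisRep 3
  -- rank and finiteness of `Ш` are carried by the isomorphism `C`
  have hrank' : (C • W).mordellWeilRank = 1 := by
    have h : (C • W).mordellWeilRank = W.mordellWeilRank := mordellWeilRank_variableChange_holds W C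
    rw [h, hrank]
  haveI : Finite (C • W).sha := (Equiv.finite_iff (shaEquiv W C)).mp hsha
  have hshap : Finite (AddCommGroup.primaryComponent (C • W).sha p) := inferInstance
  -- Kim's Cor. 1.4 for `C • W` at `p`, and invariance of the analytic rank
  have h1 := (hKim (C • W) hcm p hgt hgood hord hirr hrank' hshap).1
  rwa [analyticRank_smul] at h1

/-! ### Second addendum: Theorem A′ from Kim's Cor. 1.4 alone -/

/-- **A curve over `ℚ` with a prime of multiplicative reduction has no complex multiplication —
unconditionally** (Skinner 2020, p. 3: "If `N` is squarefree, then `A_f` does not have complex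
multiplication"): `‖j(E)‖_ℓ > 1` at a multiplicative prime `ℓ`
(`one_lt_norm_j_of_hasMultiplicativeReductionAtPrime`, Silverman *AEC* VII.5.1(b)), whereas the
`j`-invariant of a CM curve over `ℚ` is an integer (`WeierstrassCurve.not_hasCM_of_one_lt_norm_j`,
Silverman *Advanced Topics* Thm. II.6.1, a theorem of the tree). Compare
`not_hasCM_of_hasMultiplicativeReductionAtPrime`, the same relative to the named fact
`j_mem_cmJInvariants_of_hasCM`. [cite: Skinner2020, §1 (p. 3 of the held text)] [cite: SilvermanATAEC1994, Thm. II.6.1] [cite: SilvermanAEC2009, Prop. VII.5.1(b)] -/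
theorem not_hasCM_of_hasMultiplicativeReductionAtPrime' (W : WeierstrassCurve ℚ) [W.IsElliptic]
    {ℓ : ℕ} [Fact ℓ.Prime] (hmult : W.HasMultiplicativeReductionAtPrime ℓ) : ¬ W.HasCM :=
  W.not_hasCM_of_one_lt_norm_j (one_lt_norm_j_of_hasMultiplicativeReductionAtPrime hmult)

/-- **Skinner 2020, Theorem A′, from Kim 2022, Corollary 1.4 alone.** Hypothesis: Kim's Cor. 1.4
(`hKim`, tree `kim_analyticRank_eq_one_of_mordellWeilRank_eq_one`). Compared with
`skinner_analyticRank_eq_one_of_mordellWeilRank_eq_one_of_kim_of_cm`, step (i) (no CM) is now the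
tree's theorem `WeierstrassCurve.not_hasCM_of_one_lt_norm_j` applied to the global minimal model
`C • W` (`j(C • W) = j(W)`, Mathlib `variableChange_j`; `‖j(W)‖_ℓ > 1` at the multiplicative prime
`ℓ` supplied by either alternative of `hred`); the auxiliary good ordinary prime `p > 3` with `E[p]`
irreducible is `WeierstrassCurve.exists_gt_mem_goodOrdinaryPrimes_hasIrreducibleModPGaloisRep`
(*AEC* Cor. IX.6.3 with Serre 1981 §8); rank, finiteness of `Ш` and the analytic rank pass to `C • W`
(`mordellWeilRank_variableChange_holds`, `shaEquiv`, `analyticRank_smul`); Cor. 1.4 concludes. This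
is exactly Kim's deduction of Theorem A′ from Cor. 1.4 (p. 3 of the held text, Remark 1.3 and the
comparison with [skinner-converse]). Trust base of Theorem A′ after this theorem: Kim 2022 Cor. 1.4.
[cite: Kim2022, Cor. 1.4 and Remark 1.3 (p. 3 of the held text)] [cite: Skinner2020, Thm. A′ (p. 3)] -/
theorem skinner_analyticRank_eq_one_of_mordellWeilRank_eq_one_of_kim
    (hKim : kim_analyticRank_eq_one_of_mordellWeilRank_eq_one) :
    skinner_analyticRank_eq_one_of_mordellWeilRank_eq_one := by
  intro W _ _hss hred hrank hsha
  -- a prime `ℓ` of multiplicative reduction, from either alternative of `hred`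
  obtain ⟨ℓ, hℓ, hmult⟩ : ∃ ℓ : ℕ, ∃ _ : Fact ℓ.Prime, W.HasMultiplicativeReductionAtPrime ℓ := by
    rcases hred with ⟨ℓ, hℓ, -, hm, -⟩ | ⟨ℓ, -, hℓ, -, -, -, -, hs, -⟩
    · exact ⟨ℓ, hℓ, hm⟩
    · exact ⟨ℓ, hℓ, hs.hasMultiplicativeReductionAtPrime⟩
  -- a global minimal model `C • W` (Silverman VIII.8.3)
  obtain ⟨C, hC⟩ := hasGlobalMinimalModel_rat_holds W
  -- no CM, unconditionally: `j(C • W) = j(W)` is not `ℓ`-integral, CM `j`-invariants are integers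
  have hcm : ¬ (C • W).HasCM := by
    refine (C • W).not_hasCM_of_one_lt_norm_j (ℓ := ℓ) ?_
    rw [variableChange_j]
    exact one_lt_norm_j_of_hasMultiplicativeReductionAtPrime hmult
  -- a good ordinary prime `p > 3` of the minimal model with `E[p]` irreducible (AEC IX.6.3)
  obtain ⟨p, hgt, ⟨hp, hgood, hord⟩, hirr⟩ :=
    (C • W).exists_gt_mem_goodOrdinaryPrimes_hasIrreducibleModPGaloisRep 3
  -- rank and finiteness of `Ш` are carried by the isomorphism `C`
  have hrank' : (C • W).mordellWeilRank = 1 := by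
    have h : (C • W).mordellWeilRank = W.mordellWeilRank := mordellWeilRank_variableChange_holds W C
    rw [h, hrank]
  haveI : Finite (C • W).sha := (Equiv.finite_iff (shaEquiv W C)).mp hsha
  have hshap : Finite (AddCommGroup.primaryComponent (C • W).sha p) := inferInstance
  -- Kim's Cor. 1.4 for `C • W` at `p`, and invariance of the analytic rank
  have h1 := (hKim (C • W) hcm p hgt hgood hord hirr hrank' hshap).1
  rwa [analyticRank_smul] at h1

end Literature.NumberTheory.EllipticCurves

end
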